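import Literature.NumberTheory.Sieve.HeathBrownCubicTwistedSsum
import Literature.NumberTheory.Sieve.HeathBrownCubicTypeIIFinal
import HarnessLib

/-!
# Crux `HeathBrownMorozUniform` (stmt-Parity-19915), line `unit-split-positivity`: stub E5 `stub_twistedSsum`

The LOAD-BEARING stub of the merged skeleton `Cruxes/HeathBrownMorozUniform/Lines/unit_split_positivity.lean`
(registered 902c5b4b…): Heath-Brown's dispersion bound (Acta Math. 186 (2001), Lemma 12.2 + §13; tree
`Ssum_le_of_params`) for the TWISTED weight `w(β̂)F_β`, `w : ℤ³ → ℝ` `d`-periodic with `|w| ≤ 1`, under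
hypothesis (3.14) up to `d·Q₁` — the class Type II input of Heath-Brown–Moroz 2004, Prop. 4.2 (ii).
It is the Literature theorem `CubicSieve.Twisted.Ssum_le_of_params` (twisted re-run of §§11–13:
files `HeathBrownCubicTwisted{Defs,Cauchy,Localise,SmallQ,ClassISum,UstarBound,S4Bound,Ssum}`) with the
auxiliary divisor-sum inputs (`S₁`, box sum, Lemma 4.5, Lemma 11.1, tail) discharged exactly as in the tree's
`SV_le_of_params`; the statement below is the registered signature VERBATIM (`KS` depends on `d` through
`(d³C₁)²` and on `κ, c₅` through `C₁₁(κ)`, `3/c₅`).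

## References

* D. R. Heath-Brown, Acta Math. 186 (2001), Lemma 12.2, §13 pp. 82–83. [cite: HeathBrownActa2001, Lemma 12.2]
* D. R. Heath-Brown, B. Z. Moroz, Proc. London Math. Soc. 88 (2004), Prop. 4.2 (ii). [cite: HeathBrownMoroz2004, Proposition 4.2]
-/

noncomputable section

open Polynomial NumberField Finset Filter Topology Asymptotics

namespace Summit.Parity.GeneralizedHardyLittlewood.Theorems.GoldbachHeathBrownDispersionHeathBrownMorozUniform

open Literature.NumberTheory.Sieve.CubicSieve Literature.NumberTheory.Sieve.CubicPrimes
open Literature.NumberTheory.LFunctions.CubeRootTwoField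

open scoped Classical in
/-- **Stub E5 `stub_twistedSsum` of crux `HeathBrownMorozUniform` (line `unit-split-positivity`), PROVED.**
Heath-Brown's bound `S ≪ XV(Y⁻¹ + Y⁶⁰X^{-τ/2} + Y¹⁶Q₁^{-1/4} + Y¹⁶Q₁⁴e^{-c₁√log L})(log X)^{c₀}` (Lemma 12.2 +
§13) for the twisted dispersion sum `S(w) = ∑_{α̂ prim} (∑_β̂ [W(α̂β̂)] w(β̂) F_β)²`, `w` `d`-periodic, `|w| ≤ 1`,
under the parameter inequalities of the tree's `Ssum_le_of_params` verbatim and (3.14) up to `d·Q₁`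
(`KS = KS(d, κ, C₁, c₅)`). [cite: HeathBrownMoroz2004, Proposition 4.2] [cite: HeathBrownActa2001, Lemma 12.2] -/
theorem stub_twistedSsum :
  ∃ c₀ : ℝ, 0 ≤ c₀ ∧ ∀ (κ C₁ c₅ : ℝ) (d : ℕ), 0 < κ → 0 < c₅ → 0 < d → ∃ KS : ℝ, 0 < KS ∧
    ∀ (X η τ V T Y Q₁ c₁ W : ℝ) (nn : ℕ) (m : Fin (nn + 1) → ℕ) (w : ℤ × ℤ × ℤ → ℝ),
      (∀ b, |w b| ≤ 1) → (∀ b u, DvdVec (d : ℤ) u → w (b + u) = w b) →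
      0 ≤ η → η ≤ 1 → 0 < τ → τ ≤ 1 → CoreAdmissible τ m → Hyp314 X τ m ((d : ℝ) * Q₁) C₁ c₁ 3 1 →
      2 ≤ X → 1 ≤ Real.log X → 1 ≤ Y → 1 ≤ Q₁ → Q₁ ≤ X → 2 ≤ T → T ^ 3 = V → T ≤ X → T ^ 2 ≤ 56 * X →
      W = X ^ (τ / 2) → X * W ≤ T ^ 3 → T ^ 2 * W ≤ X → Y ^ 10 * Q₁ ≤ T ^ 2 → c₅ * X * Y ^ 3 ≤ T ^ 3 →
      Y ≤ X → Q₁ ^ (1 / 3 : ℝ) * Real.exp (-(c₁ * Real.sqrt (Real.log (hbL X τ)))) ≤ 1 →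
      2 ≤ T / ((1248 * (⌊Y⌋₊ + 1) ^ 2 : ℕ) : ℝ) →
      3 * (((1248 * (⌊Y⌋₊ + 1) ^ 2 : ℕ)) : ℝ) + 2 ≤ (T / ((1248 * (⌊Y⌋₊ + 1) ^ 2 : ℕ) : ℝ)) ^ 2 →
      hbL X τ ^ 2 ≤ T / ((1248 * (⌊Y⌋₊ + 1) ^ 2 : ℕ) : ℝ) → X ≤ 270 * V →
      270 * V / X ≤ κ * (T / ((1248 * (⌊Y⌋₊ + 1) ^ 2 : ℕ) : ℝ)) →
      1 ≤ V / (X * Y) → V / (X * Y) ≤ T → 1 ≤ T ^ 3 * Y ^ 7 / X →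
        ∑ a ∈ (Abox X T).filter IsPrimitiveVec,
            (∑ b ∈ Bbox T, if Wab X η a b then w b * Fb X τ m V T b else 0) ^ 2 ≤
          KS * (X * V) * (Y⁻¹ + Y ^ 60 * X ^ (-(τ / 2)) + Y ^ 16 * Q₁ ^ (-(1 / 4 : ℝ)) +
            Y ^ 16 * Q₁ ^ 4 * Real.exp (-(c₁ * Real.sqrt (Real.log (hbL X τ))))) * Real.log X ^ c₀ := by
  classical
  -- the absolute constants (as in the tree's `SV_le_of_params`)
  obtain ⟨CS, eS, hCS, heS, hS1⟩ := Twisted.exists_S1_bound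
  obtain ⟨CB, eB, hCB, hbox⟩ := exists_sum_box_idealDivisorCount_pow_le 2
  obtain ⟨C₂, e₂, hC₂, h45₂⟩ := exists_sum_latticeCube_idealDivisorCount_pow_le 2 (A := 3) (by norm_num)
  obtain ⟨C₃, e₃, hC₃, h45₃⟩ := exists_sum_latticeCube_idealDivisorCount_pow_le 3 (A := 3) (by norm_num)
  obtain ⟨CT, eT, hCT, hTL⟩ := exists_TL_bound
  obtain ⟨E, hE⟩ : ∃ E : ℕ, 2 ^ (4 * (12 * 3 + 62) + 4) + 1 = E := ⟨_, rfl⟩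
  set etot : ℝ := eS + (eB : ℝ) + eT + (E + 1 : ℕ) + (e₂ + 1 : ℕ) + (e₃ + 3 : ℕ) with hetot
  have hetot0 : 0 ≤ etot := by positivity
  refine ⟨etot, hetot0, fun κ C₁ c₅ d hκ hc₅ hd => ?_⟩
  obtain ⟨C₁₁, hC₁₁, h11⟩ := HeathBrown2001_lemma_11_1 (A := 3) (by norm_num) hκ
  rw [hE] at h11
  set KS : ℝ := CS + 2 * 81 * 27 * 87808 * 4 ^ eB * CB + 162 * CT + 2 * 81 * 34000000000 * 12 * 9 ^ 5 * (2 + 3 / c₅) * C₁₁ +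
      2 * 9 ^ 6 * 414720 * 11 * 81 * (16 + (19968 + 4992 ^ 3)) * C₂ +
      48 * 9 ^ 6 * (4992 ^ 6 * ((d : ℝ) ^ 3 * C₁) ^ 2 + 162 * 3 * (12 + (100 * 4992 ^ 2 + 16 * 4992 ^ 4)) * C₃ ^ (2 / 3 : ℝ))
    with hKS
  have hKS0 : 0 < KS := by
    have : 0 ≤ C₃ ^ (2 / 3 : ℝ) := Real.rpow_nonneg hC₃.le _
    positivity
  refine ⟨KS, hKS0, ?_⟩
  intro X η τ V T Y Q₁ c₁ W nn m w hw1 hwper hη0 hη1 hτ hτ1 hm hHyp hX hlogX hY hQ₁ hQ₁X hT2 hTV hTX hT56 hW hXW hTW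
    hYQ hc₅V hYX hQe hs2 hsN hsL hVX hκs hΔ1 hΔT hd₀
  have hT : 0 < T := by linarith
  have hT1 : 1 ≤ T := by linarith
  have hSsum := Twisted.Ssum_le_of_params (X := X) (η := η) (τ := τ) (V := V) (T := T) (Y := Y) (Q₁ := Q₁) (C₁ := C₁)
    (c₁ := c₁) (c₅ := c₅) (W := W) (m := m) (d := d) (w := w) hCS hCB hC₂ hC₃ hC₁₁ hCT heS
    (hS1 X η τ V T nn m w hw1 hX hη0 hη1 hτ hτ1 hT hTV hm)
    (by simpa [Bbox, cube] using hbox (3 * T) (by linarith))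
    h45₂ h45₃ h11 (hTL T _ hT2 hd₀) hη0 hη1 hτ hτ1 hm hd hHyp hw1 hwper hc₅ hX hlogX hY hQ₁ hQ₁X hT1 hTV hTX hT56
    hW hXW hTW hYQ hc₅V hYX hQe hs2 hsN hsL hVX hκs hΔ1 hΔT hd₀
  rw [← hKS] at hSsum
  simpa only [Twisted.Ssum, Twisted.innerSum, Twisted.Fb] using hSsum

end Summit.Parity.GeneralizedHardyLittlewood.Theorems.GoldbachHeathBrownDispersionHeathBrownMorozUniform

end
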